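import Summits.ResolutionOfSingularities.ResolutionOfSingularities.Theorems.FrobeniusClosingSteerBinaryResidueAssembly
import Literature.AlgebraicGeometry.Resolution.BlowupRingChartCoordinates
import Literature.AlgebraicGeometry.Resolution.Dehomogenization
import Literature.AlgebraicGeometry.Resolution.QuasiRegularSequences
import Literature.AlgebraicGeometry.Resolution.PointBlowupOrderChart
import HarnessLib

/-!
# NRA-A run reading, FILE 1: **the INITIAL FORM of an element of order `≥ d` read in the exceptional fibre of the `x`-chart**
# (member level; Theses-free, def-free)

OURS (campaign `res-hironaka`, rung L ★L-G4, slot W4.1 · crux `Steer` (stmt-ResolutionOfSingularities-16345) · hARᵒ H2, residue word NRA-A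
`NonRationalWindow.NonRationalAWindowTwoN` (res-L0-w41-strat-2 g4, `L/res-L0-w41-strat-2/NRA/NonRationalAWindow_words.lean` 1c74532eb9c4f0e6); RULING
284(b)(3): the run reading is res-D-repro-2's; plan `D/res-D-repro-2/NRA-A-RUNREADING-PLAN.md` steps (1)(2); seat res-D-repro-2 g9). Over the Literature
dictionary `blowupRing_chartQuotient_X` (`S[𝔪/x]/(x) ≅ κ(S)[T_j : j ≠ 0]`, Stacks 0BIQ) and `dehomogenize` ([CoP1] (10)–(11)). Not a statement of the
manuscript under review [claim: Hironaka2017, status: under-review]; AI-produced, weaker than expert review.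

SETTING: `S ⊆ K` regular local, regular system `z : Fin (n+1) → S` (`(z) = 𝔪_S`, `x := z 0 ≠ 0`), `B := blowupRing S x` the `x`-chart,
`ψ : κ(S)[T_j : j ≠ 0] → B/(x)` ANY ring map with `ψ (C s̄) = [s]` and `ψ (T_j) = [z_j/x]` (the one of `blowupRing_chartQuotient_X` is bijective).

* `exists_weakTransform_eq_initialForm` — for `F ∈ 𝔪_S^d`: a form `Φ` of degree `d` over `S` with `Φ(z) = F`, its WEAK TRANSFORM
  `F′ := Φ(1, z₁/x, …, z_n/x) ∈ B` with `F′·x^d = F`, and `[F′] = ψ(g)` for the dehomogenised reduction `g := Φ̄(T₀ := 1) ∈ κ(S)[T]`, of total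
  degree `≤ d` — the polynomial the BI-CONE lemma is applied to at a residually non-rational centre.
[cite: StacksProject, Tag 0BIQ] [cite: CossartPiltant2008, proof of Prop. 4.2, (10)–(11)] [folklore]
-/

noncomputable section

-- `Summit.<S>.<S>.…` duplicates the summit name by design (single-problem summit).
set_option linter.dupNamespace false

open IsLocalRing MvPolynomial

namespace Summit.ResolutionOfSingularities.ResolutionOfSingularities.Theorems.SwitchingDichotomy.NonRationalWindow

open Literature.AlgebraicGeometry.Resolution

variable {K : Type} [Field K]

/-- **The weak transform on the `x`-chart and its reduction = the dehomogenised initial form.** See the module docstring.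
[cite: StacksProject, Tag 0BIQ] [cite: CossartPiltant2008, proof of Prop. 4.2, (10)–(11)] [folklore] -/
theorem exists_weakTransform_eq_initialForm (S : Subring K) [IsRegularLocalRing S] {n : ℕ}
    (z : Fin (n + 1) → S) (hz : Ideal.span (Set.range z) = maximalIdeal S) (hz0 : ((z 0 : S) : K) ≠ 0)
    (ψ : MvPolynomial {j : Fin (n + 1) // j ≠ 0} (ResidueField S) →+*
      blowupRing S ((z 0 : S) : K) ⧸ Ideal.span {(⟨((z 0 : S) : K), le_blowupRing S ((z 0 : S) : K) (z 0).2⟩ : blowupRing S ((z 0 : S) : K))})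
    (hψC : ∀ s : S, ψ (MvPolynomial.C (residue S s)) = Ideal.Quotient.mk _ ⟨(s : K), le_blowupRing S ((z 0 : S) : K) s.2⟩)
    (hψX : ∀ (j : {j : Fin (n + 1) // j ≠ 0}) (h : ((z j.1 : S) : K) / ((z 0 : S) : K) ∈ blowupRing S ((z 0 : S) : K)),
      ψ (MvPolynomial.X j) = Ideal.Quotient.mk _ ⟨((z j.1 : S) : K) / ((z 0 : S) : K), h⟩)
    {d : ℕ} {F : S} (hF : F ∈ maximalIdeal S ^ d) :
    ∃ (Φ : MvPolynomial (Fin (n + 1)) S) (F' : blowupRing S ((z 0 : S) : K)),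
      Φ.IsHomogeneous d ∧ MvPolynomial.eval z Φ = F ∧
      ((F' : blowupRing S ((z 0 : S) : K)) : K) * ((z 0 : S) : K) ^ d = (F : K) ∧
      Ideal.Quotient.mk _ F' = ψ (MvPolynomial.map (residue S) (dehomogenize 0 Φ)) ∧
      (MvPolynomial.map (residue S) (dehomogenize 0 Φ)).totalDegree ≤ d := by
  classical
  set x : K := ((z 0 : S) : K) with hx
  set B : Subring K := blowupRing S x with hB
  -- the homogeneous presentation of `F`
  obtain ⟨Φ, hΦ, hΦev⟩ := exists_isHomogeneous_of_mem_span_pow z d (by rw [hz]; exact hF)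
  -- the chart coordinates `e 0 = 1`, `e j = z_j / x`
  have hzm : ∀ j, z j ∈ maximalIdeal S := fun j => hz ▸ Ideal.subset_span ⟨j, rfl⟩
  have hem : ∀ j : Fin (n + 1), ((z j : S) : K) / x ∈ B := fun j => div_mem_blowupRing x (hzm j)
  set e : Fin (n + 1) → B := fun j => if j = 0 then 1 else ⟨((z j : S) : K) / x, hem j⟩ with he
  set incl : S →+* B := Subring.inclusion (le_blowupRing S x) with hincl
  set F' : B := MvPolynomial.eval₂ incl e Φ with hF'
  refine ⟨Φ, F', hΦ, hΦev, ?_, ?_, ?_⟩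
  · -- `F′ · x^d = F`: `z = x • (e : K)` and homogeneity
    have heK : ∀ j, ((e j : B) : K) * x = ((z j : S) : K) := by
      intro j
      by_cases hj : j = 0
      · subst hj; simp [he, hx]
      · simp only [he, hj, if_false]
        exact div_mul_cancel₀ _ hz0
    have hcons : (⇑S.subtype ∘ z) = x • (fun j => ((e j : B) : K)) := by
      funext j
      simp only [Function.comp_apply, Pi.smul_apply, smul_eq_mul, Subring.coe_subtype]
      rw [mul_comm, heK]
    have h1 : (F : K) = x ^ d * MvPolynomial.eval₂ S.subtype (fun j => ((e j : B) : K)) Φ := by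
      rw [show (F : K) = S.subtype F from rfl, ← hΦev, show MvPolynomial.eval z Φ = MvPolynomial.eval₂ (RingHom.id S) z Φ from rfl,
        MvPolynomial.eval₂_comp_left, RingHom.comp_id, hcons, BinaryResidue.eval₂_smul_eq S.subtype hΦ]
    have hci : B.subtype.comp incl = S.subtype := RingHom.ext fun s => rfl
    have h2 : ((F' : B) : K) = MvPolynomial.eval₂ S.subtype (fun j => ((e j : B) : K)) Φ := by
      rw [hF', show ((MvPolynomial.eval₂ incl e Φ : B) : K) = B.subtype (MvPolynomial.eval₂ incl e Φ) from rfl,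
        MvPolynomial.eval₂_comp_left, hci]
      rfl
    rw [h2, h1, mul_comm]
  · -- `[F′] = ψ(ḡ)`: two ring maps `S[T] → B/(x)` agreeing on `C` and on the variables
    set mk := Ideal.Quotient.mk (Ideal.span {(⟨x, le_blowupRing S x (z 0).2⟩ : B)}) with hmk
    have hcomp : (mk.comp (MvPolynomial.eval₂Hom incl e)) =
        (ψ.comp (MvPolynomial.map (residue S))).comp (dehomogenize (R := S) (0 : Fin (n + 1))).toRingHom := by
      refine MvPolynomial.ringHom_ext (fun a => ?_) (fun j => ?_)
      · simp only [RingHom.comp_apply, MvPolynomial.coe_eval₂Hom, MvPolynomial.eval₂_C, AlgHom.toRingHom_eq_coe, RingHom.coe_coe,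
          MvPolynomial.algHom_C, MvPolynomial.algebraMap_eq]
        rw [MvPolynomial.map_C]
        rw [hψC]
        rfl
      · simp only [RingHom.comp_apply, MvPolynomial.coe_eval₂Hom, MvPolynomial.eval₂_X, AlgHom.toRingHom_eq_coe, RingHom.coe_coe]
        by_cases hj : j = 0
        · subst hj
          rw [show dehomogenize (R := S) (0 : Fin (n + 1)) (MvPolynomial.X 0) = 1 by
            rw [dehomogenize, MvPolynomial.aeval_X, killVar_self]]
          simp [he]
        · rw [show dehomogenize (R := S) (0 : Fin (n + 1)) (MvPolynomial.X j) = MvPolynomial.X ⟨j, hj⟩ by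
            rw [dehomogenize, MvPolynomial.aeval_X, killVar_of_ne _ hj]]
          rw [MvPolynomial.map_X, hψX ⟨j, hj⟩ (hem j)]
          simp only [he, hj, if_false]
          rfl
    have := congrArg (fun φ : MvPolynomial (Fin (n + 1)) S →+* _ => φ Φ) hcomp
    simp only [RingHom.comp_apply, MvPolynomial.coe_eval₂Hom, AlgHom.toRingHom_eq_coe, RingHom.coe_coe] at this
    rw [hF']
    exact this
  · -- degree
    refine (totalDegree_map_le _ _).trans ((totalDegree_dehomogenize_le 0 Φ).trans ?_)
    by_cases hΦ0 : Φ = 0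
    · simp [hΦ0]
    · exact (hΦ.totalDegree hΦ0).le

end Summit.ResolutionOfSingularities.ResolutionOfSingularities.Theorems.SwitchingDichotomy.NonRationalWindow

end
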